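import Summits.Ventures.HSemireg.HomComplexUnit
import Mathlib.Algebra.Homology.BifunctorShift
import HarnessLib

/-!
# Venture HSemireg — the one-term complex `E₀[0]` through `𝓗om•`: the column isomorphism commutes with the shifts,
# and the unit of `𝓗om•(E₀[0], E₀[0])` is `sheafHomUnit E₀` (steps (A2)(ii) and (A3) of the K2 anchor)

Cell `pub-hsemireg`, general-structure seat gs-g4; K2-MIN kernel plumbing on top of t-7's `HomComplex.lean` (internal Hom
complex `homComplex X E F = 𝓗om•(E•, F•)`, column isomorphism `columnIso`, natural in `F•`) and `HomComplexUnit.lean` (the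
unit `𝒪_X[0] ⟶ 𝓗om•(E•, E•)`). HONEST FRAMING: infrastructure on real carriers — NOT a door, NOT a named fact, NOT a
statement about any variety, NOT a «K2 result»; nothing here says HC, HC_CM or HC_AV is proved. PURPOSE: two of the five
inputs of the cell's K2 anchor «σ_q^C(E₀[0])(x.hom) = σ_q(E₀)(x)» (p3 HOME/lean/K2-ANCHOR-PLAN-p3.md, gs-g4
general-structure/ANCHOR-ASSEMBLY-gs-g4.md): to compare the complex-level semiregularity map of a one-term complex with the
module-level one, (A2) the descent of `𝓗om•(E₀[0], –)` to the derived category must be identified with Mathlib's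
`(𝓗om(E₀, –)).mapDerivedCategory` COMPATIBLY WITH SHIFTS (`ShiftedHom.map_naturality_1`,
`LocalizerMorphism.equiv_smallShiftedHomMap` need `NatTrans.CommShift`) — here: the cochain-level half, a sign check (Mathlib's
shift of `mapBifunctor` in the first variable, `CochainComplex.mapBifunctorShift₁Iso`, is sign-free; the shift of
`G.mapHomologicalComplex` is strict); and (A3) the unit of the complex-level map at `E₀[0]` must be the module unit
`𝒪_X → 𝓔nd(E₀)` of the tree's trace pipeline (`AtiyahClassTraceReal.traceExtCoeff`).

CONTENTS (all proved; Mathlib + tree only). For a scheme `X` and a module `E₀` (`single₀ X E₀ = E₀[0]`):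
* `HomComplex.columnNatIso X E₀ : 𝓗om•(E₀[0], –) ≅ (sheafHomFunctor E₀).mapHomologicalComplex _` — t-7's `columnIso`
  with `columnIso_hom_naturality`, packaged; the functor is spelled
  `((sheafHomBifunctor X).flip.map₂CochainComplex).flip.obj (dualComplex X (E₀[0]))` (= `HomComplex.homFunctor` of the
  venture's `HomComplexSigma.lean`, reducibly), with Mathlib's `CommShift ℤ` structure from `BifunctorShift`;
* **`HomComplex.columnNatIso_commShift : NatTrans.CommShift (columnNatIso X E₀).hom ℤ`** (+ the `.symm` instance) —
  degreewise on the summand `(q, 0)` both sides are `sheafHomMapLeft (E₀[0]⁰ ≅ E₀)⁻¹`; the other summands have zero source;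
* **`HomComplex.unit_single₀`** — `unit X E₀[0] 0 0 ≫ columnIso.hom ≫ (𝓗om(E₀, –) ∘ E₀[0] ≅ 𝓗om(E₀, E₀)[0]) =
  (sheafHomUnit E₀)[0]` (Mathlib `singleMapHomologicalComplex` for the last identification; t-7's `ι_columnHom_zero`,
  `sheafHomUnit_comp_sheafHomMapLeft`).

## References
* The Stacks project, *More on Algebra*, Section «Hom complexes» (sign conventions of `𝓗om•`). [StacksProject]
* R.-O. Buchweitz, H. Flenner, *A semiregularity map for modules and applications to deformations*, Compositio Math. 137
  (2003), §4 (the trace on `Ext` of a perfect complex through `𝓗om•`, its unit). [BuchweitzFlenner2003]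
-/

noncomputable section

open CategoryTheory CategoryTheory.Limits AlgebraicGeometry

namespace Summit.Ventures.HSemireg

open Literature.AlgebraicGeometry.Modules Literature.AlgebraicGeometry.Motives

universe u

namespace HomComplex

variable (X : Scheme.{u}) (E₀ : X.Modules)

/-- **The column isomorphism as a natural isomorphism of endofunctors** `𝓗om•(E₀[0], –) ≅ 𝓗om(E₀, –)` (termwise):
t-7's `columnIso`, natural in the complex by `columnIso_hom_naturality`. [folklore] -/
def columnNatIso :
    ((sheafHomBifunctor X).flip.map₂CochainComplex).flip.obj (dualComplex X (single₀ X E₀)) ≅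
      (sheafHomFunctor E₀).mapHomologicalComplex (ComplexShape.up ℤ) :=
  NatIso.ofComponents (fun F => columnIso X E₀ F) fun φ => columnIso_hom_naturality X E₀ φ

/-- Components of `columnNatIso`. [folklore] -/
@[simp]
lemma columnNatIso_hom_app (F : CochainComplex X.Modules ℤ) : (columnNatIso X E₀).hom.app F = (columnIso X E₀ F).hom :=
  rfl

/-- Components of `columnNatIso⁻¹`. [folklore] -/
@[simp]
lemma columnNatIso_inv_app (F : CochainComplex X.Modules ℤ) : (columnNatIso X E₀).inv.app F = (columnIso X E₀ F).inv :=
  rfl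

/-- **The column isomorphism commutes with the shifts**: `NatTrans.CommShift (columnNatIso X E₀).hom ℤ`. Degreewise, on the
summand `(q, 0)` of `𝓗om•(E₀[0], F⟦n⟧)^q` both composites are `sheafHomMapLeft (E₀[0]⁰ ≅ E₀)⁻¹ : 𝓗om(E₀[0]⁰, F^{q+n}) →
𝓗om(E₀, F^{q+n})` (Mathlib `CochainComplex.ι_mapBifunctorShift₁Iso_hom_f`, t-7's `ι_columnHom_zero`); the summands
`(q, j)`, `j ≠ 0`, have zero source. [folklore] -/
instance columnNatIso_commShift : NatTrans.CommShift (columnNatIso X E₀).hom ℤ where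
  shift_comm n := by
    ext F : 2
    refine HomologicalComplex.hom_ext _ _ fun i => ?_
    rw [NatTrans.comp_app, NatTrans.comp_app, Functor.whiskerRight_app, Functor.whiskerLeft_app,
      HomologicalComplex.comp_f, HomologicalComplex.comp_f, Functor.commShiftIso_map₂CochainComplex_flip_hom_app,
      Functor.mapHomologicalComplex_commShiftIso_eq, Functor.mapCochainComplexShiftIso_hom_app_f,
      CochainComplex.shiftFunctor_map_f']
    change (CochainComplex.mapBifunctorShift₁Iso F (dualComplex X (single₀ X E₀)) (sheafHomBifunctor X).flip n).hom.f i ≫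
        columnHom X E₀ F (i + n) = columnHom X E₀ ((shiftFunctor _ n).obj F) i ≫ 𝟙 _
    refine HomologicalComplex.mapBifunctor.hom_ext fun q j hqj => ?_
    by_cases hj : j = 0
    · subst hj
      obtain rfl : q = i := by simpa using hqj
      rw [CochainComplex.ι_mapBifunctorShift₁Iso_hom_f_assoc F _ _ n q 0 q hqj (q + n) (q + n) rfl rfl]
      simp only [CochainComplex.shiftFunctorObjXIso, HomologicalComplex.XIsoOfEq_rfl, Iso.refl_hom, Iso.refl_inv,
        Category.comp_id]
      erw [ι_columnHom_zero, ι_columnHom_zero]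
      rfl
    · exact (isZero_sheafHom_of_isZero (isZero_single₀_X X E₀ j hj) _).eq_of_src _ _

/-- The inverse column isomorphism commutes with the shifts as well. [folklore] -/
instance columnNatIso_symm_commShift : NatTrans.CommShift (columnNatIso X E₀).symm.hom ℤ := inferInstance


section UnitSingle

/-- **(A3) The unit of a one-term complex.** The unit `𝒪[0] ⟶ 𝓗om•(E₀[0], E₀[0])`, read through the column isomorphism
`𝓗om•(E₀[0], E₀[0]) ≅ 𝓗om(E₀, –) ∘ E₀[0] ≅ 𝓗om(E₀, E₀)[0]`, is the single-complex map of `sheafHomUnit E₀`. [cite: BuchweitzFlenner2003, §4 (trace map and unit)] -/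
theorem unit_single₀ :
    unit X (single₀ X E₀) 0 0 ≫ (columnIso X E₀ (single₀ X E₀)).hom ≫
        ((HomologicalComplex.singleMapHomologicalComplex (sheafHomFunctor E₀) (ComplexShape.up ℤ) 0).hom.app E₀) =
      (HomologicalComplex.single X.Modules (ComplexShape.up ℤ) 0).map (sheafHomUnit E₀) := by
  refine HomologicalComplex.from_single_hom_ext ?_
  rw [HomologicalComplex.comp_f, HomologicalComplex.comp_f, unit, HomologicalComplex.mkHomFromSingle_f,
    HomologicalComplex.single_map_f_self, HomologicalComplex.singleMapHomologicalComplex_hom_app_self,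
    Category.assoc]
  congr 1
  -- unitDeg₀ at a = b = 0 is the single summand i = 0
  rw [unitDeg₀, neg_zero, Finset.Icc_self, Finset.sum_singleton, unitSummand, Category.assoc]
  change sheafHomUnit ((single₀ X E₀).X (-0)) ≫ ι X (single₀ X E₀) (single₀ X E₀) (-0) 0 0 (by simp) ≫
    columnHom X E₀ (single₀ X E₀) 0 ≫ sheafHomMap E₀ (HomologicalComplex.singleObjXSelf (ComplexShape.up ℤ) 0 E₀).hom ≫
      (HomologicalComplex.singleObjXSelf (ComplexShape.up ℤ) 0 (sheafHom E₀ E₀)).inv =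
    sheafHomUnit E₀ ≫ (HomologicalComplex.singleObjXSelf (ComplexShape.up ℤ) 0 (sheafHom E₀ E₀)).inv
  erw [reassoc_of% (ι_columnHom_zero X E₀ (single₀ X E₀) 0)]
  erw [reassoc_of% (sheafHomUnit_comp_sheafHomMapLeft (single₀XIso X E₀ 0 rfl).inv)]

end UnitSingle

end HomComplex

end Summit.Ventures.HSemireg

end
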